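import Summits.AtomisticToContinuum.FouriersLaw.Theses.BondHeatUncertainty
import Summits.AtomisticToContinuum.FouriersLaw.Theorems.BondHeatUncertaintySubdiffusiveBondHeatSiteEnergyDynkinTruncation
import Literature.MathematicalPhysics.KineticTheory.SdeGeneratorCalculus
import Mathlib.MeasureTheory.Integral.DominatedConvergence

/-!
# Energy cut-off calculus and polynomial moments (helper 1 for `stub_steadyHeatRates`)

Helper file for crux `stmt-AtomisticToContinuum-9122` (`BondHeatUncertainty.LinearResponseFTUR`), line
`lebesgue-flip-duality`, stub `stub_steadyHeatRates`. A weak steady state `μ` of the pinned chain satisfies the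
stationary Fokker–Planck equation `∫ L f dμ = 0` only for `f ∈ C_c^∞` (`OscillatorChain.IsSteadyState`); the steady
heat rates need it for polynomial observables. The extension (helper 2) truncates with the energy cut-off `χ(H/R)`
(`smoothCutoff` of the tree); this file supplies the calculus and the moments:

* `smoothCutoff_div_of_lt`, `deriv_deriv_smoothCutoff_eq_zero_of_notMem` — `χ(H/R) = 1`, `χ' = χ'' = 0` on `{H < R}`
  (the derivative of `v ↦ χ'(v/R)/R` is the sibling's `hasDerivAt_deriv_scaled_smoothCutoff`, `…SiteEnergyDynkinTruncation`);
* `generator_comp_hamiltonian_closed`, `carreDuChamp_hamiltonian` — closed forms of `L(F∘H)` and `Γ(H, f)` (`N ≥ 1`);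
* `generator_mul_cutoff` — the product rule `L(fχ_R) = χ_R Lf + f Lχ_R + χ'(H/R)/R · Γ(H, f)` for `C²` observables
  (through the tree's `sdeGenerator` calculus, `SdeGeneratorCalculus.lean`);
* `pinnedChain_integrable_one_add_hamiltonian_pow` / `pinnedChain_polynomialMoments` (registered sub-goal) —
  `(1 + H)^m ∈ L¹(μ)` from one exponential moment;
* `abs_three_terms_le` — the bookkeeping inequality behind the uniform bound `|L(fχ_R)| ≤ K(1+H)^{k+1}`.

Nothing here closes an item.
-/

noncomputable section

namespace Summit.AtomisticToContinuum.FouriersLaw.Theorems.LinearResponseFTUR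

open MeasureTheory Filter Topology Set
open scoped ContDiff NNReal ENNReal
open Literature.MathematicalPhysics.KineticTheory
open Literature.MathematicalPhysics.KineticTheory.HeatConduction
open Summit.AtomisticToContinuum.FouriersLaw.Theorems.SubdiffusiveBondHeat

/-! ### The smooth cutoff at small arguments -/

/-- `χ'' = 0` off `[1, 2]` (`χ'` vanishes on the open complement). [folklore] -/
theorem deriv_deriv_smoothCutoff_eq_zero_of_notMem {u : ℝ} (hu : u ∉ Icc (1:ℝ) 2) :
    deriv (deriv smoothCutoff) u = 0 := by
  rw [mem_Icc, not_and_or, not_le, not_le] at hu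
  have h : deriv smoothCutoff =ᶠ[𝓝 u] fun _ => (0:ℝ) := by
    rcases hu with hu | hu
    · filter_upwards [Iio_mem_nhds hu] with v hv
      exact deriv_smoothCutoff_eq_zero_of_notMem fun h => (not_le.2 hv) h.1
    · filter_upwards [Ioi_mem_nhds hu] with v hv
      exact deriv_smoothCutoff_eq_zero_of_notMem fun h => (not_le.2 hv) h.2
  rw [h.deriv_eq, deriv_const]

/-- For `u < R` (`R > 0`): `χ(u/R) = 1`, `χ'(u/R) = 0`, `χ''(u/R) = 0`. [folklore] -/
theorem smoothCutoff_div_of_lt {u R : ℝ} (hR : 0 < R) (hu : u < R) :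
    smoothCutoff (u / R) = 1 ∧ deriv smoothCutoff (u / R) = 0 ∧
      deriv (deriv smoothCutoff) (u / R) = 0 := by
  have h1 : u / R < 1 := (div_lt_one hR).2 hu
  have hn : u / R ∉ Icc (1:ℝ) 2 := fun h => (not_le.2 h1) h.1
  exact ⟨smoothCutoff_of_le_one h1.le, deriv_smoothCutoff_eq_zero_of_notMem hn,
    deriv_deriv_smoothCutoff_eq_zero_of_notMem hn⟩

/-- `|χ| ≤ 1`. [folklore] -/
theorem abs_smoothCutoff_le_one (u : ℝ) : |smoothCutoff u| ≤ 1 :=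
  abs_le.2 ⟨by linarith [smoothCutoff_nonneg u], smoothCutoff_le_one u⟩

/-! ### Closed forms: a sum over the bath sites, `L(F∘H)`, `Γ(H, f)` -/

/-- `∑_i [i = k] a_i = a_k` for an index value `k < N`. [folklore] -/
theorem sum_ite_val_eq {N k : ℕ} (hk : k < N) (a : Fin N → ℝ) :
    ∑ i : Fin N, (if i.val = k then a i else 0) = a ⟨k, hk⟩ := by
  rw [Finset.sum_eq_single_of_mem (⟨k, hk⟩ : Fin N) (Finset.mem_univ _)]
  · simp
  · intro b _ hb
    rw [if_neg]
    exact fun h => hb (Fin.ext h)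

/-- **`L(F∘H)` in closed form** (`N ≥ 1`): only the two baths act,
`L(F∘H) = γ [(T_L (F''p_0² + F') - F' p_0²) + (T_R (F''p_{N-1}² + F') - F' p_{N-1}²)]` (at `H`). [folklore] -/
theorem generator_comp_hamiltonian_closed (P : OscillatorChain) {N : ℕ} (hN : 0 < N)
    (hH : Differentiable ℝ (P.hamiltonian N)) {F F' F'' : ℝ → ℝ}
    (hF : ∀ u, HasDerivAt F (F' u) u) (hF' : ∀ u, HasDerivAt F' (F'' u) u) (T_L T_R : ℝ)
    (x : PhaseSpace N) :
    P.generator N T_L T_R (fun y => F (P.hamiltonian N y)) x =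
      P.γ * ((T_L * (F'' (P.hamiltonian N x) * x.2 ⟨0, hN⟩ ^ 2 + F' (P.hamiltonian N x)) -
          F' (P.hamiltonian N x) * x.2 ⟨0, hN⟩ ^ 2) +
        (T_R * (F'' (P.hamiltonian N x) * x.2 ⟨N - 1, Nat.sub_lt hN one_pos⟩ ^ 2 +
            F' (P.hamiltonian N x)) -
          F' (P.hamiltonian N x) * x.2 ⟨N - 1, Nat.sub_lt hN one_pos⟩ ^ 2)) := by
  rw [P.generator_comp_hamiltonian hH hF hF' T_L T_R x, Finset.sum_add_distrib,
    sum_ite_val_eq hN (fun i => T_L * (F'' (P.hamiltonian N x) * x.2 i ^ 2 + F' (P.hamiltonian N x)) -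
      F' (P.hamiltonian N x) * x.2 i ^ 2),
    sum_ite_val_eq (Nat.sub_lt hN one_pos) (fun i => T_R * (F'' (P.hamiltonian N x) * x.2 i ^ 2 +
      F' (P.hamiltonian N x)) - F' (P.hamiltonian N x) * x.2 i ^ 2)]

/-- **`Γ(H, f)` in closed form** (`N ≥ 1`): `Γ(H,f) = 2γT_L p_0 ∂_{p_0}f + 2γT_R p_{N-1} ∂_{p_{N-1}}f`, written with
the squared noise amplitudes `(√(2γT_b))²`. [folklore] -/
theorem carreDuChamp_hamiltonian (P : OscillatorChain) {N : ℕ} (hN : 0 < N)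
    (hH : Differentiable ℝ (P.hamiltonian N)) {f : PhaseSpace N → ℝ} (hf : Differentiable ℝ f)
    (T_L T_R : ℝ) (x : PhaseSpace N) :
    carreDuChamp (P.bathVecL N T_L) (P.bathVecR N T_R) (P.hamiltonian N) f x =
      Real.sqrt (2 * P.γ * T_L) ^ 2 * (x.2 ⟨0, hN⟩ * partialP ⟨0, hN⟩ f x) +
        Real.sqrt (2 * P.γ * T_R) ^ 2 *
          (x.2 ⟨N - 1, Nat.sub_lt hN one_pos⟩ * partialP ⟨N - 1, Nat.sub_lt hN one_pos⟩ f x) := by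
  have h1 : ∀ {k : ℕ} (hk : k < N) (c : ℝ),
      fderiv ℝ f x (bathVec N k c) = c * partialP ⟨k, hk⟩ f x := by
    intro k hk c
    rw [bathVec_eq_smul_unitP hk, map_smul, smul_eq_mul, partialP_eq_fderiv hf, unitP_eq]
  rw [carreDuChamp_def]
  simp only [OscillatorChain.bathVecL, OscillatorChain.bathVecR]
  rw [fderiv_hamiltonian_bathVec P hH x hN, fderiv_hamiltonian_bathVec P hH x (Nat.sub_lt hN one_pos),
    h1 hN, h1 (Nat.sub_lt hN one_pos)]
  ring

/-- **Product rule for the energy cut-off** (`N ≥ 1`, `γT_L, γT_R ≥ 0`, `H, f ∈ C²`):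
`L(f χ(H/R)) = χ(H/R) Lf + f L(χ(H/R)) + (χ'(H/R)/R) Γ(H, f)`. [folklore] -/
theorem generator_mul_cutoff (P : OscillatorChain) {N : ℕ} (hN : 0 < N) {T_L T_R : ℝ}
    (hγL : 0 ≤ P.γ * T_L) (hγR : 0 ≤ P.γ * T_R) (hH2 : ContDiff ℝ 2 (P.hamiltonian N))
    {f : PhaseSpace N → ℝ} (hf : ContDiff ℝ 2 f) (R : ℝ) (x : PhaseSpace N) :
    P.generator N T_L T_R (fun y => f y * smoothCutoff (P.hamiltonian N y / R)) x =
      smoothCutoff (P.hamiltonian N x / R) * P.generator N T_L T_R f x +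
        f x * P.generator N T_L T_R (fun y => smoothCutoff (P.hamiltonian N y / R)) x +
        deriv smoothCutoff (P.hamiltonian N x / R) / R *
          carreDuChamp (P.bathVecL N T_L) (P.bathVecR N T_R) (P.hamiltonian N) f x := by
  have hχ2 : ContDiff ℝ 2 fun y => smoothCutoff (P.hamiltonian N y / R) :=
    (contDiff_smoothCutoff (n := 2)).comp (hH2.div_const R)
  have hprod : ContDiff ℝ 2 fun y => f y * smoothCutoff (P.hamiltonian N y / R) := hf.mul hχ2
  have hΓ : carreDuChamp (P.bathVecL N T_L) (P.bathVecR N T_R)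
      (fun y => smoothCutoff (P.hamiltonian N y / R)) f x =
      deriv smoothCutoff (P.hamiltonian N x / R) / R *
        carreDuChamp (P.bathVecL N T_L) (P.bathVecR N T_R) (P.hamiltonian N) f x :=
    carreDuChamp_comp_left _ _ (hasDerivAt_scaled_smoothCutoff R) (hH2.differentiable (by norm_num)) f x
  rw [← P.sdeGenerator_drift_eq_generator hN hγL hγR hprod,
    ← P.sdeGenerator_drift_eq_generator hN hγL hγR hf,
    ← P.sdeGenerator_drift_eq_generator hN hγL hγR hχ2,
    sdeGenerator_mul' _ _ _ hf hχ2 x, carreDuChamp_comm, hΓ]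
  ring

/-! ### Polynomial moments from one exponential moment -/

/-- `(1 + t)^m ≤ (m!/ϑ^m) e^{ϑ} e^{ϑ t}` for `t ≥ 0`, `ϑ > 0`. [folklore] -/
theorem one_add_pow_le_mul_exp (m : ℕ) {ϑ : ℝ} (hϑ : 0 < ϑ) {t : ℝ} (ht : 0 ≤ t) :
    (1 + t) ^ m ≤ (m.factorial / ϑ ^ m * Real.exp ϑ) * Real.exp (ϑ * t) := by
  have h := Real.pow_div_factorial_le_exp (ϑ * (1 + t)) (by positivity) m
  rw [mul_pow] at h
  rw [mul_add, mul_one, Real.exp_add] at h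
  have hm : (0:ℝ) < m.factorial := by positivity
  have hϑm : 0 < ϑ ^ m := by positivity
  rw [div_le_iff₀ hm] at h
  calc (1 + t) ^ m = (ϑ ^ m * (1 + t) ^ m) / ϑ ^ m := by field_simp
    _ ≤ (Real.exp ϑ * Real.exp (ϑ * t) * m.factorial) / ϑ ^ m := by gcongr
    _ = (m.factorial / ϑ ^ m * Real.exp ϑ) * Real.exp (ϑ * t) := by ring

/-- **Polynomial moments of the energy** under a law with one exponential moment (pinned chain,
`ω₂, lam, β ≥ 0`): `(1 + H)^m ∈ L¹(μ)` for every `m`. [folklore] -/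
theorem pinnedChain_integrable_one_add_hamiltonian_pow {ω₂ lam β : ℝ} (hω : 0 ≤ ω₂) (hl : 0 ≤ lam)
    (hβ : 0 ≤ β) (γ : ℝ) (N : ℕ) {μ : Measure (PhaseSpace N)} {ϑ : ℝ} (hϑ : 0 < ϑ)
    (hint : Integrable (fun x => Real.exp (ϑ * (pinnedChain ω₂ lam β γ).hamiltonian N x)) μ) (m : ℕ) :
    Integrable (fun x => (1 + (pinnedChain ω₂ lam β γ).hamiltonian N x) ^ m) μ := by
  refine (hint.const_mul (m.factorial / ϑ ^ m * Real.exp ϑ)).mono' ?_ (Eventually.of_forall fun x => ?_)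
  · exact ((continuous_const.add (pinnedChain_continuous_hamiltonian ω₂ lam β γ N)).pow m).aestronglyMeasurable
  · have hH0 := pinnedChain_hamiltonian_nonneg hω hl hβ γ N x
    rw [Real.norm_eq_abs, abs_of_nonneg (by positivity)]
    exact one_add_pow_le_mul_exp m hϑ hH0

/-! ### The extension of the weak Fokker–Planck equation -/

/-- An algebraic bookkeeping inequality for the three terms of `L(fχ_R)`. [folklore] -/
theorem abs_three_terms_le {χv Lf fx mid F' Γ C a h K₁ M₁ G : ℝ} (hχ : |χv| ≤ 1)
    (hLf : |Lf| ≤ C * a) (hf : |fx| ≤ C * a) (hmid : |mid| ≤ K₁ * (1 + h)) (hF' : |F'| ≤ M₁)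
    (hΓ : |Γ| ≤ G * (C * a) * (1 + h)) (hC : 0 ≤ C) (ha : 0 ≤ a) (hh : 0 ≤ h) :
    |χv * Lf + fx * mid + F' * Γ| ≤ (C + C * K₁ + M₁ * G * C) * (a * (1 + h)) := by
  have hK₁ : 0 ≤ K₁ * (1 + h) := le_trans (abs_nonneg _) hmid
  have hM₁ : 0 ≤ M₁ := le_trans (abs_nonneg _) hF'
  have hG : 0 ≤ G * (C * a) * (1 + h) := le_trans (abs_nonneg _) hΓ
  have h1 : |χv * Lf| ≤ C * a * (1 + h) := by
    rw [abs_mul]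
    calc |χv| * |Lf| ≤ 1 * (C * a) := mul_le_mul hχ hLf (abs_nonneg _) zero_le_one
      _ = C * a * 1 := by ring
      _ ≤ C * a * (1 + h) := by gcongr; linarith
  have h2 : |fx * mid| ≤ C * a * (K₁ * (1 + h)) := by
    rw [abs_mul]
    exact mul_le_mul hf hmid (abs_nonneg _) (by positivity)
  have h3 : |F' * Γ| ≤ M₁ * (G * (C * a) * (1 + h)) := by
    rw [abs_mul]
    exact mul_le_mul hF' hΓ (abs_nonneg _) hM₁
  calc |χv * Lf + fx * mid + F' * Γ| ≤ |χv * Lf| + |fx * mid| + |F' * Γ| := abs_add_three _ _ _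
    _ ≤ C * a * (1 + h) + C * a * (K₁ * (1 + h)) + M₁ * (G * (C * a) * (1 + h)) := by linarith
    _ = (C + C * K₁ + M₁ * G * C) * (a * (1 + h)) := by ring

/-- **Polynomial moments of the energy from one exponential moment** (registered sub-goal of
`stub_steadyHeatRates`; closed form of `pinnedChain_integrable_one_add_hamiltonian_pow`): for the pinned chain with
`ω₂, lam, β ≥ 0`, any `γ`, any law `μ` on phase space integrating `e^{ϑH}` for some `ϑ > 0`, every power `(1 + H)^m`
is `μ`-integrable. [folklore] -/
theorem pinnedChain_polynomialMoments :
    ∀ (ω₂ lam β γ : ℝ), 0 ≤ ω₂ → 0 ≤ lam → 0 ≤ β → ∀ (N : ℕ) (μ : Measure (PhaseSpace N)) (ϑ : ℝ), 0 < ϑ →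
    Integrable (fun x => Real.exp (ϑ * (pinnedChain ω₂ lam β γ).hamiltonian N x)) μ →
    ∀ m : ℕ, Integrable (fun x => (1 + (pinnedChain ω₂ lam β γ).hamiltonian N x) ^ m) μ := by
  intro ω₂ lam β γ hω hl hβ N μ ϑ hϑ hint m
  exact pinnedChain_integrable_one_add_hamiltonian_pow hω hl hβ γ N hϑ hint m

end Summit.AtomisticToContinuum.FouriersLaw.Theorems.LinearResponseFTUR

end
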